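import Mathlib.Analysis.SpecialFunctions.Pow.Real
import HarnessLib

/-!
# S2β · THE SUP CHAIN ∕ (D-stage): THE ρ̃-COLUMN BUDGET FROM ITS THREE COLUMN BUDGETS — the real bookkeeping behind FILE P's
# `ρt := ρS + ρA + 2(4sU+aU)·mA + 2(4sA+aA)·mA`: `Σ_t w_t·Σ_B ρt² ≤ 4(C_S + C_A)·PU + 4(β_S + β_A + 2c²·β_m)·S′` with `c := 2(4σ_M + a_M)` (the FB-σ number's home)

Cell `ym3-torus` (rung R3 = continuum `SU(2)` Yang–Mills on T³ at fixed lattice data — NOT d = 4, NOT infinite volume, NOT a mass gap, NOT Clay).  Width seat «width 12»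
`ym3-torus-px12` (gen 26), FREE px helper on crux `stmt-QuantumFields-20520`; `--supports` helper, count-neutral, DEFINITION-FREE (0 `def`∕`instance`∕`notation`∕`sorry`,
default heartbeats).

WHY (px21 g25 00:13:52Z «ρ̃-BUDGET ASSEMBLY — px12 assembles: the `(a+b+c+d)² ≤ 4Σ` split, Q's size letters and the FB-σ closed form are your lineage; my three column
names: ✓p838489 `rhoA_column_budget`, ⧗`mA_column_budget`, px10's ✓`hP_of_chartTower` for ρS»).  THIS FILE is the assembly's ARITHMETIC, index-generic (any finite
index type `ι` for the top bonds `B`, any level weights `w t ≥ 0`, any number of levels `N`), so that the tower-level inhabitant of px20's (η)-AT socket `hPρ` is ONE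
application of it to the three landed column budgets: with `ρt t B := ρS t B + ρA t B + cU t·mA t B + cA t·mA t B`, `0 ≤ cU t, cA t ≤ c`, and column budgets
`Σ_t w_t Σ_B ρS² ≤ C_S·PU + β_S·S′`, `Σ_t w_t Σ_B ρA² ≤ C_A·PU + β_A·S′`, `Σ_t w_t Σ_B mA² ≤ β_m·S′` (PU = the purse term `e^{cΣθ′}·purse`, S′ = the station's READ′
sum — both just reals here): `Σ_t w_t Σ_B ρt² ≤ 4(C_S + C_A)·PU + 4(β_S + β_A + 2c²β_m)·S′`.  THE FB-σ NUMBER (RULING «FB-σ», architect 22:21:56Z; px21 22:17:02Z):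
in P, `cU t = 2(4·sU t + aU t)`, `cA t = 2(4·sA t + aA t)` with `sU, sA ≤ σ_M := s₀ + D₁·α₀` (✓p836168 Q: `σ_t ≤ s₀q^n + D₁α`) and `aU, aA ≤ a_M` (θ∕(k3)-class), so
`c = 2(4σ_M + a_M)` and the ρ̃ column's `S′`-share is `βρ = 4(β_S + β_A + 8(4σ_M + a_M)²·β_m)`; the (η)-AT socket asks `2·2·(π∕2)²·((2h)(2+2h))²·βρ ≤ 1∕96`
(`h = (L−1)∕2`) — with `β_m = (11∕10)²·L⁻¹·(2d·13^d)` (px21's mA column) this is the inequality the guard threshold `s₀` must meet (G1′: NOT met at `s₀ = 1∕128`, L = 3;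
the planner's class constant).

WHAT IS PROVED (sorry-free).  ★★★`rhoTilde_budget_of_columns` (the assembly inequality above; the four-term Cauchy–Schwarz is a local `have`, = lit
✓`MatomakiRadziwillThm3.sq_add_four_le`, kept inline so the imports stay inside the lineage).

HONEST SCOPE.  Real-number bookkeeping only; the three column budgets and the size bounds are HYPOTHESES; nothing of Bałaban's renormalisation-group analysis is
asserted or proved ([Balaban1985RegularSpaces] (1.29) p.81; [Balaban1985Averaging] Prop. 4 pp.37–38 — conventions only).  The tower-level `hPρ` inhabitant (P's
region letters as explicit Pi-sups + the five inhabitation letters + this arithmetic + the smallness conjunct), the smallness itself (FB-σ ∕ G1′), the knit, GAP♯∘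
(registry UNTOUCHED by me), the five registered stubs (0∕5), S2β, 20520, 19936, 19200, `YM3TorusSU2` are NOT proved; rung R3 — NOT d = 4, NOT infinite volume, NOT a
mass gap, NOT Clay; the Yang–Mills mass gap is NOT proved.
-/

set_option autoImplicit false

namespace Summit.QuantumFields.YangMills.Theorems.FluctuationComparisonRegPrIntLS2BetaRhoTildeBudgetOfColumns

open Finset

/-- ★★★ **THE ρ̃-COLUMN BUDGET FROM ITS THREE COLUMN BUDGETS**: for nonneg level weights `w`, a finite index type of top bonds, per-(level, bond) letters
`ρS, ρA, mA` and per-level coefficients `0 ≤ cU t, cA t ≤ c`, the column budgets `Σ_{t<N} w t·Σ_B ρS² ≤ C_S·PU + β_S·S′`, `Σ w·Σ ρA² ≤ C_A·PU + β_A·S′`,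
`Σ w·Σ mA² ≤ β_m·S′` give `Σ_{t<N} w t·Σ_B (ρS + ρA + cU t·mA + cA t·mA)² ≤ 4(C_S + C_A)·PU + 4(β_S + β_A + 2c²·β_m)·S′`. [folklore] -/
theorem rhoTilde_budget_of_columns {ι : Type*} [Fintype ι] (N : ℕ) (w : ℕ → ℝ) (hw : ∀ t, 0 ≤ w t)
    (ρS ρA mA : ℕ → ι → ℝ) (cU cA : ℕ → ℝ) {c : ℝ}
    (hcU0 : ∀ t, 0 ≤ cU t) (hcU : ∀ t, cU t ≤ c) (hcA0 : ∀ t, 0 ≤ cA t) (hcA : ∀ t, cA t ≤ c)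
    {PU S' C_S C_A β_S β_A β_m : ℝ}
    (hS : ∑ t ∈ range N, w t * ∑ B, ρS t B ^ 2 ≤ C_S * PU + β_S * S')
    (hA : ∑ t ∈ range N, w t * ∑ B, ρA t B ^ 2 ≤ C_A * PU + β_A * S')
    (hM : ∑ t ∈ range N, w t * ∑ B, mA t B ^ 2 ≤ β_m * S') :
    ∑ t ∈ range N, w t * ∑ B, (ρS t B + ρA t B + cU t * mA t B + cA t * mA t B) ^ 2 ≤
      4 * (C_S + C_A) * PU + 4 * (β_S + β_A + 2 * c ^ 2 * β_m) * S' := by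
  -- pointwise split, then the column budgets
  -- (`(Σ_4 u)² ≤ 4 Σ u²`, Cauchy–Schwarz; = lit ✓`MatomakiRadziwillThm3.sq_add_four_le`, restated inline to keep this file's imports inside the S2β lineage)
  have sum_sq_four_le : ∀ a b c d : ℝ, (a + b + c + d) ^ 2 ≤ 4 * (a ^ 2 + b ^ 2 + c ^ 2 + d ^ 2) := fun a b c d => by
    nlinarith [sq_nonneg (a - b), sq_nonneg (a - c), sq_nonneg (a - d), sq_nonneg (b - c), sq_nonneg (b - d), sq_nonneg (c - d)]
  have hpt : ∀ t B, (ρS t B + ρA t B + cU t * mA t B + cA t * mA t B) ^ 2 ≤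
      4 * (ρS t B ^ 2 + ρA t B ^ 2 + c ^ 2 * mA t B ^ 2 + c ^ 2 * mA t B ^ 2) := by
    intro t B
    have h4 := sum_sq_four_le (ρS t B) (ρA t B) (cU t * mA t B) (cA t * mA t B)
    have hU2 : (cU t * mA t B) ^ 2 ≤ c ^ 2 * mA t B ^ 2 := by
      rw [mul_pow]; exact mul_le_mul_of_nonneg_right (pow_le_pow_left₀ (hcU0 t) (hcU t) 2) (sq_nonneg _)
    have hA2 : (cA t * mA t B) ^ 2 ≤ c ^ 2 * mA t B ^ 2 := by
      rw [mul_pow]; exact mul_le_mul_of_nonneg_right (pow_le_pow_left₀ (hcA0 t) (hcA t) 2) (sq_nonneg _)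
    linarith
  have hpt' : ∀ t B, (ρS t B + ρA t B + cU t * mA t B + cA t * mA t B) ^ 2 ≤
      4 * ρS t B ^ 2 + 4 * ρA t B ^ 2 + 8 * c ^ 2 * mA t B ^ 2 := fun t B => by linarith [hpt t B]
  -- level by level: `w t·Σ_B (…)² ≤ 4·(w t Σ ρS²) + 4·(w t Σ ρA²) + 8c²·(w t Σ mA²)`
  have hlev : ∀ t, w t * ∑ B, (ρS t B + ρA t B + cU t * mA t B + cA t * mA t B) ^ 2 ≤
      4 * (w t * ∑ B, ρS t B ^ 2) + 4 * (w t * ∑ B, ρA t B ^ 2) + 8 * c ^ 2 * (w t * ∑ B, mA t B ^ 2) := by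
    intro t
    have h1 : ∑ B, (ρS t B + ρA t B + cU t * mA t B + cA t * mA t B) ^ 2 ≤
        ∑ B, (4 * ρS t B ^ 2 + 4 * ρA t B ^ 2 + 8 * c ^ 2 * mA t B ^ 2) := sum_le_sum fun B _ => hpt' t B
    have h2 : ∑ B, (4 * ρS t B ^ 2 + 4 * ρA t B ^ 2 + 8 * c ^ 2 * mA t B ^ 2) =
        4 * ∑ B, ρS t B ^ 2 + 4 * ∑ B, ρA t B ^ 2 + 8 * c ^ 2 * ∑ B, mA t B ^ 2 := by
      rw [sum_add_distrib, sum_add_distrib, mul_sum, mul_sum, mul_sum]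
    have h3 := mul_le_mul_of_nonneg_left (h1.trans h2.le) (hw t)
    linarith [h3]
  have hsum := sum_le_sum fun t (_ : t ∈ range N) => hlev t
  rw [sum_add_distrib, sum_add_distrib, ← mul_sum, ← mul_sum, ← mul_sum] at hsum
  have h8 : 0 ≤ 8 * c ^ 2 := by positivity
  have hM' := mul_le_mul_of_nonneg_left hM h8
  linarith [hsum, hS, hA, hM']

end Summit.QuantumFields.YangMills.Theorems.FluctuationComparisonRegPrIntLS2BetaRhoTildeBudgetOfColumns
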